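import Summits.CriticalPhenomena.Ising3DConformalLimit.Theses.HyperoctahedralRP
import HarnessLib

/-!
# Limits of ratio inequalities: stub `stub_ratioTransfer` of line `inversion-defect-involution`
# for crux `InversionUpgradeNormalised` (stmt-CriticalPhenomena-1982)

Let `S` be a pointwise scaling limit of the critical Ising correlators `G_m = criticalCorr 3 m`
with renormalisation `ρ > 0` on `(0,1]`.  For a configuration `z` of `n + 2` points write
`z' = z ∘ Fin.castAdd 2` (first `n` points), `z'' = z ∘ Fin.natAdd n` (last two points), and
consider the weight-free lattice ratio
`R^δ_n(z) = G_n([z'/δ]) G_2([z''/δ]) / G_{n+2}([z/δ])` and the limit ratio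
`R_S(z) = S_n(z') S_2(z'') / S_{n+2}(z)`.

* `tendsto_latticeRatio`: at a non-coincident `z` with `S_{n+2}(z) ≠ 0`, `R^δ_n(z) → R_S(z)` as
  `δ → 0⁺`.  Indeed for `δ ∈ (0,1]` the renormalisations cancel,
  `R^δ_n(z) = (ρ^n G_n)(ρ^2 G_2) / (ρ^{n+2} G_{n+2})`, and the three rescaled correlators converge
  (`TendstoLocallyUniformlyOn.tendsto_at` at the non-coincident sub-configurations `z', z'', z`).
* `stub_ratioTransfer`: if moreover `R^δ_n(x) ≤ R^δ_n(y) + ε` eventually for every `ε > 0`, then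
  `R_S(x) ≤ R_S(y)` (`le_of_tendsto_of_tendsto`, `le_of_forall_pos_le_add`).

Theorem-only file (no new definitions); Mathlib + `Literature.Probability.LatticeModels.ScalingLimit`.
-/

noncomputable section

open Filter Topology
open Literature.Probability.LatticeModels EuclideanGeometry

namespace Summit.CriticalPhenomena.Ising3DConformalLimit.Cruxes.InversionUpgradeNormalised.InversionDefectInvolution

/-- The first `n` points of a non-coincident configuration of `n + 2` points are non-coincident. -/
theorem nonCoincident_castAdd {n : ℕ} {x : Fin (n + 2) → EuclideanSpace ℝ (Fin 3)}
    (hx : x ∈ NonCoincident 3 (n + 2)) :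
    (fun i => x (Fin.castAdd 2 i)) ∈ NonCoincident 3 n :=
  (mem_nonCoincident _).2 (((mem_nonCoincident _).1 hx).comp (Fin.castAdd_injective n 2))

/-- The last two points of a non-coincident configuration of `n + 2` points are non-coincident. -/
theorem nonCoincident_natAdd {n : ℕ} {x : Fin (n + 2) → EuclideanSpace ℝ (Fin 3)}
    (hx : x ∈ NonCoincident 3 (n + 2)) :
    (fun i => x (Fin.natAdd n i)) ∈ NonCoincident 3 2 :=
  (mem_nonCoincident _).2 (((mem_nonCoincident _).1 hx).comp (Fin.natAdd_injective 2 n))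

/-- **Convergence of the weight-free lattice ratio.**  If `S` is a pointwise scaling limit of
`criticalCorr 3` with renormalisation `ρ > 0` on `(0,1]`, then at every non-coincident
configuration `x` of `n + 2` points with `S_{n+2}(x) ≠ 0` the lattice ratio
`G_n([x'/δ]) G_2([x''/δ]) / G_{n+2}([x/δ])` tends, as `δ → 0⁺`, to the limit ratio
`S_n(x') S_2(x'') / S_{n+2}(x)` (the renormalisations `ρ(δ)^n ρ(δ)^2 = ρ(δ)^{n+2}` cancel). -/
theorem tendsto_latticeRatio {ρ : ℝ → ℝ} {S : CorrFamily 3}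
    (hρ : ∀ δ ∈ Set.Ioc (0:ℝ) 1, 0 < ρ δ)
    (hlim : HasPointwiseScalingLimit (criticalCorr 3) ρ S) {n : ℕ}
    {x : Fin (n + 2) → EuclideanSpace ℝ (Fin 3)} (hx : x ∈ NonCoincident 3 (n + 2))
    (hSx : S (n + 2) x ≠ 0) :
    Tendsto (fun δ : ℝ =>
        criticalCorr 3 n (fun i => latticeApprox δ (x (Fin.castAdd 2 i))) *
            criticalCorr 3 2 (fun i => latticeApprox δ (x (Fin.natAdd n i))) /
          criticalCorr 3 (n + 2) (fun i => latticeApprox δ (x i)))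
      (𝓝[>] (0:ℝ))
      (𝓝 (S n (fun i => x (Fin.castAdd 2 i)) * S 2 (fun i => x (Fin.natAdd n i)) /
        S (n + 2) x)) := by
  have h := (((hlim n).tendsto_at (nonCoincident_castAdd hx)).mul
    ((hlim 2).tendsto_at (nonCoincident_natAdd hx))).div ((hlim (n + 2)).tendsto_at hx) hSx
  refine h.congr' ?_
  filter_upwards [Ioc_mem_nhdsGT (zero_lt_one' ℝ)] with δ hδ
  have hρδ : ρ δ ^ (n + 2) ≠ 0 := pow_ne_zero _ (hρ δ hδ).ne'
  simp only [Pi.div_apply, rescaledCorrelator_apply]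
  rw [mul_mul_mul_comm, ← pow_add, mul_div_mul_left _ _ hρδ]

/-- **stub_ratioTransfer** (B; limits of inequalities).  If `S` is a pointwise scaling limit of
`criticalCorr 3` (renormalisation `ρ > 0` on `(0,1]`), `x, y` are non-coincident configurations of
`n + 2` points at which `S_{n+2}` does not vanish, and for every `ε > 0` eventually (as `δ → 0⁺`)
`R^δ_n(x) ≤ R^δ_n(y) + ε` for the weight-free lattice ratios
`R^δ_n(z) = G_n([z'/δ]) G_2([z''/δ]) / G_{n+2}([z/δ])`, then the limit ratios satisfy
`R_S(x) ≤ R_S(y)`, `R_S(z) = S_n(z') S_2(z'') / S_{n+2}(z)`. -/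
theorem stub_ratioTransfer :
    ∀ (ρ : ℝ → ℝ) (S : CorrFamily 3), (∀ δ ∈ Set.Ioc (0:ℝ) 1, 0 < ρ δ) →
      HasPointwiseScalingLimit (criticalCorr 3) ρ S →
      ∀ (n : ℕ) (x y : Fin (n + 2) → EuclideanSpace ℝ (Fin 3)),
        x ∈ NonCoincident 3 (n + 2) → y ∈ NonCoincident 3 (n + 2) →
        S (n + 2) x ≠ 0 → S (n + 2) y ≠ 0 →
        (∀ ε : ℝ, 0 < ε → ∀ᶠ δ in 𝓝[>] (0:ℝ),
          criticalCorr 3 n (fun i => latticeApprox δ (x (Fin.castAdd 2 i))) *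
              criticalCorr 3 2 (fun i => latticeApprox δ (x (Fin.natAdd n i))) /
            criticalCorr 3 (n + 2) (fun i => latticeApprox δ (x i)) ≤
          criticalCorr 3 n (fun i => latticeApprox δ (y (Fin.castAdd 2 i))) *
              criticalCorr 3 2 (fun i => latticeApprox δ (y (Fin.natAdd n i))) /
            criticalCorr 3 (n + 2) (fun i => latticeApprox δ (y i)) + ε) →
        S n (fun i => x (Fin.castAdd 2 i)) * S 2 (fun i => x (Fin.natAdd n i)) /
            S (n + 2) x ≤
        S n (fun i => y (Fin.castAdd 2 i)) * S 2 (fun i => y (Fin.natAdd n i)) /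
            S (n + 2) y := by
  intro ρ S hρ hlim n x y hx hy hSx hSy hε
  refine le_of_forall_pos_le_add fun ε εpos => ?_
  exact le_of_tendsto_of_tendsto (tendsto_latticeRatio hρ hlim hx hSx)
    ((tendsto_latticeRatio hρ hlim hy hSy).add_const ε) (hε ε εpos)

end Summit.CriticalPhenomena.Ising3DConformalLimit.Cruxes.InversionUpgradeNormalised.InversionDefectInvolution

end
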